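import Summits.CriticalPhenomena.Ising3DConformalLimit.Theses.SynchronousCoupling
import Summits.CriticalPhenomena.Ising3DConformalLimit.Theorems.MoebiusLimitExists.Negative.PinnedClusterPoints
import Summits.CriticalPhenomena.Ising3DConformalLimit.Theorems.MoebiusLimitExists.Negative.TwoPointPositivity
import HarnessLib

/-!
# Load-bearing hypotheses of crux `UniformRegularity` (item stmt-CriticalPhenomena-4658) — negative lemmas

Refuter birth-vetting of the crux in route `SynchronousCoupling` (the decl is definitionally the shared item of routes
`ClusterRigidity` / `MirrorHoelderCompactness` / `MonotoneRG`). THEOREM-ONLY file, no positive route-item conclusion;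
the renormalisation is written exactly as in the item, `ρ★(δ) = ⟨σ₀σ_{⌊δ⁻¹⌋e₀}⟩^{-1/2}` (the tree's `rhoPin` uses `⌊1/δ⌋`).

* `clauseA_false_without_nonCoincident` : clause (a) (local boundedness of the pinned rescaled correlators, uniformly in
  the mesh) with the hypothesis `K ⊆ NonCoincident 3 n` DROPPED is false — witness the compact singleton `K = {(0,0)}`,
  where `F_δ(2; 0, 0) = ⟨σ₀σ_{⌊δ⁻¹⌋e₀}⟩⁻¹ → ∞` by the infrared upper bound `⟨σ₀σ_x⟩ ≤ C‖x‖⁻¹`;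
* `clauseA_false_without_compact` : clause (a) with `IsCompact K` DROPPED is false — witness the non-compact
  `K = {(0, t e₀) : t ∈ (0,1]} ⊆ NonCoincident 3 2`, where `F_δ(2; 0, δe₀) = ⟨σ₀σ_{e₀}⟩ / ⟨σ₀σ_{⌊δ⁻¹⌋e₀}⟩ → ∞`;
* `clauseC_false_without_compact` : clause (c) (positive lower bound at `n = 2`) with `IsCompact K` DROPPED is false —
  witness `K = {(0, t e₀) : 1 ≤ t}`: at fixed mesh `F_δ(2; 0, t e₀) → 0` as `t → ∞`;
* `pinned_normalisation` : `F_δ(2; 0, e₀) = 1` for every mesh (no free multiplicative constant; clause (c) forces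
  `m ≤ 1` on any `K ∋ (0, e₀)`); `exists_mesh_inv_twoPoint_gt` : `ρ★(δ)²` is unbounded as `δ → 0⁺`.

So any proof of clause (a) must use both `K ⊆ NonCoincident` and `IsCompact K`, and any proof of clause (c) must use `IsCompact K`. (The orders `n = 0` and odd `n` are
trivially true instances — `rescaledCorrelator_arity_zero/odd` of `MoebiusLimitOfTwoPointLaw/Negative/TwoPointConvergence`
— and at even `n ≥ 2` the crux is equivalent to item 6150 `TwoPointDoubling`, `uniformRegularity_iff_doubling`.)
References: B. Simon, Comm. Math. Phys. 77 (1980) 111; J. Fröhlich, B. Simon, T. Spencer, Comm. Math. Phys. 50 (1976) 79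
(the window `c‖x‖⁻² ≤ ⟨σ₀σ_x⟩_{β_c} ≤ C‖x‖⁻¹`, tree theorem `criticalTwoPoint_bounds_holds`).
-/

open Summit.CriticalPhenomena.Ising3DConformalLimit.Theses
open Literature.Probability.LatticeModels
open Filter Set
open scoped Topology
open Summit.CriticalPhenomena.Ising3DConformalLimit.PinnedClusterPoints (criticalTwoPoint_pos3)
open Summit.CriticalPhenomena.Ising3DConformalLimit.MoebiusLimitExistsNegative (latticeApprox_single)

namespace Summit.CriticalPhenomena.Ising3DConformalLimit.UniformRegularityNegative

/-- The hypotheses of the crux have a non-empty model: a compact set of non-coincident pairs. [folklore] -/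
theorem hyps_satisfiable : ∃ K : Set (Fin 2 → EuclideanSpace ℝ (Fin 3)),
    K ⊆ NonCoincident 3 2 ∧ IsCompact K ∧ K.Nonempty := by
  refine ⟨{![0, EuclideanSpace.single (0 : Fin 3) (1:ℝ)]}, ?_, isCompact_singleton, Set.singleton_nonempty _⟩
  intro x hx
  rw [Set.mem_singleton_iff] at hx
  subst hx
  exact zero_unitVec_mem_nonCoincident one_ne_zero

/-- `ρ★(δ)² = ⟨σ₀σ_{⌊δ⁻¹⌋e₀}⟩⁻¹`. [folklore] -/
theorem rhoStar_sq (δ : ℝ) :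
    (fun δ : ℝ => (criticalTwoPoint 3 (Pi.single 0 ⌊δ⁻¹⌋)) ^ (-(1/2:ℝ))) δ ^ 2 =
      (criticalTwoPoint 3 (Pi.single 0 ⌊δ⁻¹⌋))⁻¹ := by
  have hg : 0 ≤ criticalTwoPoint 3 (Pi.single 0 ⌊δ⁻¹⌋) := (criticalTwoPoint_pos3 _).le
  show ((criticalTwoPoint 3 (Pi.single 0 ⌊δ⁻¹⌋)) ^ (-(1/2:ℝ))) ^ 2 = _
  rw [← Real.rpow_natCast, ← Real.rpow_mul hg, show (-(1/2:ℝ)) * ((2:ℕ):ℝ) = -1 by norm_num, Real.rpow_neg_one]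

/-- The lattice configuration of `(0, t e₀)` at mesh `δ` is `(0, ⌊t/δ⌋ e₀)`. [folklore] -/
theorem latticeCfg_pair_unitVec (δ t : ℝ) :
    (fun i => latticeApprox δ ((![0, EuclideanSpace.single (0 : Fin 3) t] : Fin 2 → EuclideanSpace ℝ (Fin 3)) i)) =
      ![0, Pi.single (0 : Fin 3) ⌊t / δ⌋] := by
  funext i
  fin_cases i
  · simp [latticeApprox_zero]
  · simpa using latticeApprox_single δ t

/-- The pinned rescaled pair correlator at `(0, t e₀)` is `⟨σ₀σ_{⌊t/δ⌋e₀}⟩ / ⟨σ₀σ_{⌊δ⁻¹⌋e₀}⟩`. [folklore] -/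
theorem rescaled_pair_unitVec (δ t : ℝ) :
    rescaledCorrelator (criticalCorr 3) (fun δ : ℝ => (criticalTwoPoint 3 (Pi.single 0 ⌊δ⁻¹⌋)) ^ (-(1/2:ℝ))) 2 δ
        ![0, EuclideanSpace.single (0 : Fin 3) t] =
      (criticalTwoPoint 3 (Pi.single 0 ⌊δ⁻¹⌋))⁻¹ * criticalTwoPoint 3 (Pi.single (0 : Fin 3) ⌊t / δ⌋) := by
  rw [rescaledCorrelator_apply, rhoStar_sq, latticeCfg_pair_unitVec, criticalCorr_two]

/-- **Pinned normalisation**: `F_δ(2; 0, e₀) = 1` for every mesh `δ`. [folklore] -/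
theorem pinned_normalisation (δ : ℝ) :
    rescaledCorrelator (criticalCorr 3) (fun δ : ℝ => (criticalTwoPoint 3 (Pi.single 0 ⌊δ⁻¹⌋)) ^ (-(1/2:ℝ))) 2 δ
        ![0, EuclideanSpace.single (0 : Fin 3) (1:ℝ)] = 1 := by
  rw [rescaled_pair_unitVec, one_div, inv_mul_cancel₀ (criticalTwoPoint_pos3 _).ne']

/-- The pinned rescaled pair correlator at the coincident pair `(0, 0)` is `⟨σ₀σ_{⌊δ⁻¹⌋e₀}⟩⁻¹`. [folklore] -/
theorem rescaled_pair_origin (δ : ℝ) :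
    rescaledCorrelator (criticalCorr 3) (fun δ : ℝ => (criticalTwoPoint 3 (Pi.single 0 ⌊δ⁻¹⌋)) ^ (-(1/2:ℝ))) 2 δ
        ![0, 0] = (criticalTwoPoint 3 (Pi.single 0 ⌊δ⁻¹⌋))⁻¹ := by
  have h := rescaled_pair_unitVec δ 0
  have h0 : (EuclideanSpace.single (0 : Fin 3) (0:ℝ) : EuclideanSpace ℝ (Fin 3)) = 0 := by simp
  rw [h0] at h
  rw [h, zero_div, Int.floor_zero, Pi.single_zero, criticalTwoPoint_zero', mul_one]

/-- **`ρ★²` is unbounded**: for every `M` and `δ₀ > 0` there is a mesh `δ = 1/N ∈ (0, δ₀)`, `δ ≤ 1`, with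
`⟨σ₀σ_{N e₀}⟩⁻¹ > M` (infrared upper bound `⟨σ₀σ_x⟩ ≤ C‖x‖⁻¹`). [folklore] -/
theorem exists_mesh_inv_twoPoint_gt (M δ₀ : ℝ) (hδ₀ : 0 < δ₀) :
    ∃ δ ∈ Set.Ioo 0 δ₀, δ ≤ 1 ∧ M < (criticalTwoPoint 3 (Pi.single 0 ⌊δ⁻¹⌋))⁻¹ := by
  obtain ⟨c, C, hc, hb⟩ := criticalTwoPoint_bounds_holds (d := 3) (by norm_num)
  obtain ⟨N, hN⟩ := exists_nat_gt (max (max (M * C) δ₀⁻¹) 1)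
  have hN1 : (1:ℝ) < N := lt_of_le_of_lt (le_max_right _ _) hN
  have hNpos : (0:ℝ) < N := one_pos.trans hN1
  have hMC : M * C < N := lt_of_le_of_lt ((le_max_left _ _).trans (le_max_left _ _)) hN
  have hδN : δ₀⁻¹ < N := lt_of_le_of_lt ((le_max_right _ _).trans (le_max_left _ _)) hN
  refine ⟨(N:ℝ)⁻¹, ⟨inv_pos.2 hNpos, ?_⟩, inv_le_one_of_one_le₀ hN1.le, ?_⟩
  · calc (N:ℝ)⁻¹ < (δ₀⁻¹)⁻¹ := (inv_lt_inv₀ hNpos (inv_pos.2 hδ₀)).2 hδN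
      _ = δ₀ := inv_inv δ₀
  rw [inv_inv, Int.floor_natCast]
  have hNne : ((N:ℕ):ℤ) ≠ 0 := by
    have : (N:ℕ) ≠ 0 := by rintro rfl; norm_num at hN1
    exact_mod_cast this
  have hx : (Pi.single (0 : Fin 3) ((N:ℕ):ℤ) : Site 3) ≠ 0 := by
    intro h0
    have := congrFun h0 0
    rw [Pi.single_eq_same] at this
    exact hNne this
  have hub : criticalTwoPoint 3 (Pi.single 0 ((N:ℕ):ℤ)) ≤ C * (N:ℝ)⁻¹ := by
    have h2 := (hb _ hx).2
    rw [norm_single_axis, Int.cast_natCast, abs_of_pos hNpos,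
      show (-(((3:ℕ):ℝ) - 2)) = -1 by norm_num, Real.rpow_neg_one] at h2
    exact h2
  have hgpos : 0 < criticalTwoPoint 3 (Pi.single 0 ((N:ℕ):ℤ)) := criticalTwoPoint_pos3 _
  by_contra hle
  rw [not_lt] at hle
  -- `g⁻¹ ≤ M` with `g > 0` forces `0 < M` and `1 = g⁻¹ g ≤ M g ≤ M C / N < 1`
  have hMpos : 0 < M := (inv_pos.2 hgpos).trans_le hle
  have h1 : (1:ℝ) ≤ M * criticalTwoPoint 3 (Pi.single 0 ((N:ℕ):ℤ)) := by
    rw [← inv_mul_cancel₀ hgpos.ne']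
    exact mul_le_mul_of_nonneg_right hle hgpos.le
  have h2 : M * criticalTwoPoint 3 (Pi.single 0 ((N:ℕ):ℤ)) ≤ M * C / N := by
    rw [mul_div_assoc, div_eq_mul_inv]
    exact mul_le_mul_of_nonneg_left hub hMpos.le
  have h3 : M * C / N < 1 := (div_lt_one hNpos).2 hMC
  linarith

/-- **`K ⊆ NonCoincident` is load-bearing.** Clause (a) of the crux with the non-coincidence hypothesis dropped is
FALSE: at the compact singleton `K = {(0,0)}`, `F_δ(2; 0, 0) = ⟨σ₀σ_{⌊δ⁻¹⌋e₀}⟩⁻¹ → ∞`. [folklore] -/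
theorem clauseA_false_without_nonCoincident :
    ¬ (∀ (n : ℕ) (K : Set (Fin n → EuclideanSpace ℝ (Fin 3))), IsCompact K →
        ∃ M δ₀ : ℝ, 0 < δ₀ ∧ ∀ δ ∈ Set.Ioo 0 δ₀, ∀ x ∈ K,
          |rescaledCorrelator (criticalCorr 3)
              (fun δ : ℝ => (criticalTwoPoint 3 (Pi.single 0 ⌊δ⁻¹⌋)) ^ (-(1/2:ℝ))) n δ x| ≤ M) := by
  intro h
  obtain ⟨M, δ₀, hδ₀, hM⟩ := h 2 {![0, 0]} isCompact_singleton
  obtain ⟨δ, hδ, -, hlt⟩ := exists_mesh_inv_twoPoint_gt M δ₀ hδ₀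
  have hb := hM δ hδ _ (Set.mem_singleton _)
  rw [rescaled_pair_origin, abs_of_pos (inv_pos.2 (criticalTwoPoint_pos3 _))] at hb
  linarith

/-- **`IsCompact K` is load-bearing.** Clause (a) of the crux with compactness dropped is FALSE: on the non-compact
`K = {(0, t e₀) : t ∈ (0,1]} ⊆ NonCoincident 3 2`, `F_δ(2; 0, δ e₀) = ⟨σ₀σ_{e₀}⟩/⟨σ₀σ_{⌊δ⁻¹⌋e₀}⟩ → ∞`. [folklore] -/
theorem clauseA_false_without_compact :
    ¬ (∀ (n : ℕ) (K : Set (Fin n → EuclideanSpace ℝ (Fin 3))), K ⊆ NonCoincident 3 n →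
        ∃ M δ₀ : ℝ, 0 < δ₀ ∧ ∀ δ ∈ Set.Ioo 0 δ₀, ∀ x ∈ K,
          |rescaledCorrelator (criticalCorr 3)
              (fun δ : ℝ => (criticalTwoPoint 3 (Pi.single 0 ⌊δ⁻¹⌋)) ^ (-(1/2:ℝ))) n δ x| ≤ M) := by
  intro h
  set K : Set (Fin 2 → EuclideanSpace ℝ (Fin 3)) :=
    {x | ∃ t ∈ Set.Ioc (0:ℝ) 1, x = ![0, EuclideanSpace.single (0 : Fin 3) t]} with hK
  have hKnc : K ⊆ NonCoincident 3 2 := by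
    rintro x ⟨t, ht, rfl⟩
    exact zero_unitVec_mem_nonCoincident ht.1.ne'
  obtain ⟨M, δ₀, hδ₀, hM⟩ := h 2 K hKnc
  have hg1 : 0 < criticalTwoPoint 3 (Pi.single (0 : Fin 3) 1) := criticalTwoPoint_pos3 _
  obtain ⟨δ, hδ, hδ1, hlt⟩ := exists_mesh_inv_twoPoint_gt (M / criticalTwoPoint 3 (Pi.single (0 : Fin 3) 1)) δ₀ hδ₀
  have hxK : (![0, EuclideanSpace.single (0 : Fin 3) δ] : Fin 2 → EuclideanSpace ℝ (Fin 3)) ∈ K :=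
    ⟨δ, ⟨hδ.1, hδ1⟩, rfl⟩
  have hb := hM δ hδ _ hxK
  rw [rescaled_pair_unitVec, div_self hδ.1.ne', Int.floor_one,
    abs_of_pos (mul_pos (inv_pos.2 (criticalTwoPoint_pos3 _)) hg1)] at hb
  have := (div_lt_iff₀ hg1).1 hlt
  linarith

/-- **`IsCompact K` is load-bearing for clause (c) too.** Clause (c) (uniform positive lower bound of the pinned pair
correlator) with compactness dropped is FALSE: on the closed non-compact `K = {(0, t e₀) : 1 ≤ t} ⊆ NonCoincident 3 2`
and any fixed mesh `δ`, `F_δ(2; 0, t e₀) = ⟨σ₀σ_{⌊t/δ⌋e₀}⟩/⟨σ₀σ_{⌊δ⁻¹⌋e₀}⟩ → 0` as `t → ∞` (infrared upper bound). [folklore] -/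
theorem clauseC_false_without_compact :
    ¬ (∀ K : Set (Fin 2 → EuclideanSpace ℝ (Fin 3)), K ⊆ NonCoincident 3 2 →
        ∃ m δ₀ : ℝ, 0 < m ∧ 0 < δ₀ ∧ ∀ δ ∈ Set.Ioo 0 δ₀, ∀ x ∈ K,
          m ≤ rescaledCorrelator (criticalCorr 3)
            (fun δ : ℝ => (criticalTwoPoint 3 (Pi.single 0 ⌊δ⁻¹⌋)) ^ (-(1/2:ℝ))) 2 δ x) := by
  intro h
  set K : Set (Fin 2 → EuclideanSpace ℝ (Fin 3)) :=
    {x | ∃ t : ℝ, 1 ≤ t ∧ x = ![0, EuclideanSpace.single (0 : Fin 3) t]} with hK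
  have hKnc : K ⊆ NonCoincident 3 2 := by
    rintro x ⟨t, ht, rfl⟩
    exact zero_unitVec_mem_nonCoincident (one_pos.trans_le ht).ne'
  obtain ⟨m, δ₀, hm, hδ₀, hM⟩ := h K hKnc
  have hδ : δ₀ / 2 ∈ Set.Ioo 0 δ₀ := ⟨by positivity, by linarith⟩
  have hA : 0 < (criticalTwoPoint 3 (Pi.single 0 ⌊(δ₀ / 2)⁻¹⌋))⁻¹ := inv_pos.2 (criticalTwoPoint_pos3 _)
  obtain ⟨δ', hδ', -, hlt⟩ :=
    exists_mesh_inv_twoPoint_gt ((criticalTwoPoint 3 (Pi.single 0 ⌊(δ₀ / 2)⁻¹⌋))⁻¹ / m) (δ₀ / 2) hδ.1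
  have ht1 : 1 ≤ δ₀ / 2 / δ' := by rw [le_div_iff₀ hδ'.1, one_mul]; exact hδ'.2.le
  have hxK : (![0, EuclideanSpace.single (0 : Fin 3) (δ₀ / 2 / δ')] : Fin 2 → EuclideanSpace ℝ (Fin 3)) ∈ K :=
    ⟨δ₀ / 2 / δ', ht1, rfl⟩
  have hb := hM (δ₀ / 2) hδ _ hxK
  rw [rescaled_pair_unitVec, div_right_comm, div_self hδ.1.ne', one_div] at hb
  have hg' : 0 < criticalTwoPoint 3 (Pi.single 0 ⌊δ'⁻¹⌋) := criticalTwoPoint_pos3 _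
  -- `A/m < g⁻¹` gives `A g < m`, contradicting `m ≤ A g`
  have h1 : (criticalTwoPoint 3 (Pi.single 0 ⌊(δ₀ / 2)⁻¹⌋))⁻¹ / m * criticalTwoPoint 3 (Pi.single 0 ⌊δ'⁻¹⌋) < 1 := by
    have := mul_lt_mul_of_pos_right hlt hg'
    rwa [inv_mul_cancel₀ hg'.ne'] at this
  have h2 : (criticalTwoPoint 3 (Pi.single 0 ⌊(δ₀ / 2)⁻¹⌋))⁻¹ * criticalTwoPoint 3 (Pi.single 0 ⌊δ'⁻¹⌋) < m := by
    have h3 := mul_lt_mul_of_pos_left h1 hm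
    rw [mul_one, ← mul_assoc, mul_div_cancel₀ _ hm.ne'] at h3
    exact h3
  linarith

end Summit.CriticalPhenomena.Ising3DConformalLimit.UniformRegularityNegative
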